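import Mathlib
import Summits.NavierStokesRegularity.NavierStokesRegularity.Theorems.EulerZoomLiouvillePowerGaugeEulerLiouvilleSwirlfreeLedgerDecay
import Summits.NavierStokesRegularity.NavierStokesRegularity.Theorems.EulerZoomLiouvillePowerGaugeEulerLiouvilleNeedleAxisymBand
import Literature.Analysis.FluidPDE.TaoEnstrophyLocalisation
import Literature.Analysis.FluidPDE.KinematicApexWitness
import Literature.Analysis.FluidPDE.AxisymmetricEuler
import Literature.Analysis.FluidPDE.ClassicalSolution
import HarnessLib

/-!
# Crux `EulerZoomLiouville.PowerGaugeEulerLiouville` (stmt-NavierStokesRegularity-19832), width sub-line `casimir_haul` (ns-idea-11 g10/g11),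
# H4 toolkit — TREE PORT of the line file's proved lemmas (REV2, `Lines/casimir_haul.lean` 1c8959c20491f31e, `section H4Kit`)

Seat ns-ezl-w3 g8 (`--supports stmt-NavierStokesRegularity-19832 --as helper`); proofs by ns-idea-11 g11 (in the Cruxes workfile, which Theorems
cannot import), ported verbatim with the line's `ledgerBlob` / `IsLedgerFlow` δ-unfolded to the clauses actually used:
* `CasimirHaul.exists_ledgerBlob_pos` — a slice with vorticity somewhere has a marked Casimir blob
  `{x ∈ B̄(0,R₀) : λ r(x) ≤ |curl u(t₀,x)|}` of positive volume (`λ ≤ 1`);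
* `CasimirHaul.moment_le_frobenius` — FLOOR `λ² r² ≤ |curl u|² ≤ 16 ‖∇u‖²_F` on the transported blob: `∫_{Y(S) ∩ B_a} r² ≤ (16/λ²) ∫_{B_a} ‖∇u(s)‖²_F`;
* `CasimirHaul.window_frobenius_le_single` — the single-scale `E`-budget `∫_{(−a²,0)×B_a} ‖∇u‖²_F ≤ c a^{1−ρ}` of a classical member;
* `CasimirHaul.moment_budget` — `∫_{t₁}^{t₀} ∫_{X_s(S) ∩ B_a} r² ≤ (16/λ²) c a^{1−ρ}` on a window `(t₁,t₀) ⊆ (−a²,0]`;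
* `CasimirHaul.exists_banished` — RESIDENCE ⇒ BANISHMENT (tube bathtub `NeedleAxisymBand.sq_volume_le_integral_cylRadius_sq` against the moment budget);
* `CasimirHaul.three_b_rpow_le` — `(3b)^{1−ρ} ≤ 3 b^{1−min ρ 1}`.

HONEST FRAMING: tools for a width sub-line of the MODEL-lattice crux class; nothing about the crux E (19832 OPEN) or NS regularity; not E.
[cite: CaffarelliKohnNirenberg1982, §2; MajdaBertozziCUP2002, §2.3.3]
-/

noncomputable section

set_option linter.dupNamespace false

open MeasureTheory Set Filter Topology Metric Function
open scoped NNReal ENNReal ContDiff Topology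

namespace Summit.NavierStokesRegularity.NavierStokesRegularity.Theorems.PowerGaugeEulerLiouville.CasimirHaul

open Literature.Analysis Literature.Analysis.FluidPDE
open Summit.NavierStokesRegularity.NavierStokesRegularity.Theorems.PowerGaugeEulerLiouville

variable {u : ℝ → EuclideanSpace ℝ (Fin 3) → EuclideanSpace ℝ (Fin 3)} {p : ℝ → EuclideanSpace ℝ (Fin 3) → ℝ}

/-! ### The blob -/

/-- **If a slice carries vorticity somewhere, some marked Casimir blob (with `λ ≤ 1`) has positive volume.** (ns-idea-11 g11, ported.) [folklore] -/
theorem exists_ledgerBlob_pos (hcl : IsClassicalEulerSolutionOn (Set.Iio 0) 0 u p) {t₀ : ℝ} (ht₀ : t₀ < 0)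
    {x₀ : EuclideanSpace ℝ (Fin 3)} (hx₀ : curl (u t₀) x₀ ≠ 0) :
    ∃ lam R₀ : ℝ, 0 < lam ∧ lam ≤ 1 ∧ 0 < R₀ ∧
      0 < volume {x : EuclideanSpace ℝ (Fin 3) | x ∈ Metric.closedBall (0 : EuclideanSpace ℝ (Fin 3)) R₀ ∧
        lam * cylRadius x ≤ ‖curl (u t₀) x‖} := by
  have hc : Continuous (curl (u t₀)) := by
    have hv : ContDiff ℝ 1 (u t₀) := (hcl.contDiff_velocity (show t₀ ∈ Set.Iio 0 from ht₀)).of_le (by norm_cast)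
    rw [curl_eq_curlCLM_comp]
    exact curlCLM.continuous.comp (hv.continuous_fderiv one_ne_zero)
  set κ : ℝ := ‖curl (u t₀) x₀‖ with hκdef
  have hκ : 0 < κ := norm_pos_iff.2 hx₀
  have hopen : IsOpen {x : EuclideanSpace ℝ (Fin 3) | κ / 2 < ‖curl (u t₀) x‖} := isOpen_lt continuous_const hc.norm
  have hx₀mem : x₀ ∈ {x : EuclideanSpace ℝ (Fin 3) | κ / 2 < ‖curl (u t₀) x‖} := by
    show κ / 2 < ‖curl (u t₀) x₀‖; rw [← hκdef]; linarith
  obtain ⟨δ, hδ, hball⟩ := Metric.isOpen_iff.1 hopen x₀ hx₀mem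
  set R₀ : ℝ := ‖x₀‖ + δ + 1 with hR₀def
  have hR₀ : 0 < R₀ := by positivity
  set lam : ℝ := min 1 (κ / (2 * R₀)) with hlamdef
  have hlam : 0 < lam := lt_min one_pos (by positivity)
  refine ⟨lam, R₀, hlam, min_le_left _ _, hR₀, ?_⟩
  have hsub : Metric.ball x₀ δ ⊆ {x : EuclideanSpace ℝ (Fin 3) | x ∈ Metric.closedBall (0 : EuclideanSpace ℝ (Fin 3)) R₀ ∧
      lam * cylRadius x ≤ ‖curl (u t₀) x‖} := by
    intro x hx
    have hxn : ‖x‖ ≤ ‖x₀‖ + δ := by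
      have h1 : dist x x₀ < δ := hx
      rw [dist_eq_norm] at h1
      calc ‖x‖ = ‖(x - x₀) + x₀‖ := by rw [sub_add_cancel]
        _ ≤ ‖x - x₀‖ + ‖x₀‖ := norm_add_le _ _
        _ ≤ ‖x₀‖ + δ := by linarith
    refine ⟨?_, ?_⟩
    · rw [Metric.mem_closedBall, dist_zero_right]; linarith
    · have hκx : κ / 2 < ‖curl (u t₀) x‖ := hball hx
      have hrn : cylRadius x ≤ ‖x‖ := by
        have h1 : cylRadius x ^ 2 ≤ ‖x‖ ^ 2 := by
          rw [cylRadius_sq, EuclideanSpace.norm_sq_eq, Fin.sum_univ_three]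
          simp only [Real.norm_eq_abs, sq_abs]
          nlinarith [sq_nonneg (x 2)]
        exact (pow_le_pow_iff_left₀ (cylRadius_nonneg x) (norm_nonneg x) two_ne_zero).1 h1
      have hr : cylRadius x ≤ R₀ := hrn.trans (by linarith)
      have hlamle : lam ≤ κ / (2 * R₀) := min_le_right _ _
      calc lam * cylRadius x ≤ κ / (2 * R₀) * R₀ :=
            mul_le_mul hlamle hr (cylRadius_nonneg x) (by positivity)
        _ = κ / 2 := by field_simp
        _ ≤ ‖curl (u t₀) x‖ := hκx.le
  exact lt_of_lt_of_le (Metric.measure_ball_pos volume x₀ hδ) (measure_mono hsub)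

/-! ### The moment budget (FLOOR + `E`-gauge) -/

/-- **Pointwise-in-time FLOOR**: if `Y '' S` is measurable and `λ r(Y y) ≤ |curl u(s, Y y)|` on `S` (`λ > 0`, `s < 0`), then
`∫_{Y(S) ∩ B_a} r² ≤ (16/λ²) ∫_{B_a} ‖∇u(s)‖²_F`. (ns-idea-11 g11, ported.) [folklore] -/
theorem moment_le_frobenius (hcl : IsClassicalEulerSolutionOn (Set.Iio 0) 0 u p) {lam : ℝ} (hlam : 0 < lam)
    {S : Set (EuclideanSpace ℝ (Fin 3))} {Y : EuclideanSpace ℝ (Fin 3) → EuclideanSpace ℝ (Fin 3)} {s : ℝ} (hs0 : s < 0)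
    (hmeas : MeasurableSet (Y '' S)) (hfloor : ∀ y ∈ S, lam * cylRadius (Y y) ≤ ‖curl (u s) (Y y)‖) (a : ℝ) :
    ∫⁻ x in Y '' S ∩ Metric.ball (0 : EuclideanSpace ℝ (Fin 3)) a, ENNReal.ofReal (cylRadius x ^ 2) ≤
      ENNReal.ofReal (16 / lam ^ 2) *
        ∫⁻ x in Metric.ball (0 : EuclideanSpace ℝ (Fin 3)) a, ENNReal.ofReal (frobeniusNormSq (fderiv ℝ (u s) x)) := by
  have hv : ContDiff ℝ 1 (u s) := (hcl.contDiff_velocity (show s ∈ Set.Iio 0 from hs0)).of_le (by norm_cast)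
  have hFm : Measurable fun x => ENNReal.ofReal (frobeniusNormSq (fderiv ℝ (u s) x)) :=
    (continuous_frobeniusNormSq_fderiv hv one_ne_zero).measurable.ennreal_ofReal
  have hpt : ∀ x ∈ Y '' S ∩ Metric.ball (0 : EuclideanSpace ℝ (Fin 3)) a,
      ENNReal.ofReal (cylRadius x ^ 2) ≤ ENNReal.ofReal (16 / lam ^ 2) * ENNReal.ofReal (frobeniusNormSq (fderiv ℝ (u s) x)) := by
    rintro x ⟨⟨y, hy, rfl⟩, -⟩
    have h1 := hfloor y hy
    have h2 := SwirlfreeLedger.sq_norm_curl_le_frobeniusNormSq (u s) (Y y)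
    have h3 : (lam * cylRadius (Y y)) ^ 2 ≤ ‖curl (u s) (Y y)‖ ^ 2 :=
      pow_le_pow_left₀ (mul_nonneg hlam.le (cylRadius_nonneg _)) h1 2
    have h4 : cylRadius (Y y) ^ 2 ≤ 16 / lam ^ 2 * frobeniusNormSq (fderiv ℝ (u s) (Y y)) := by
      rw [div_mul_eq_mul_div, le_div_iff₀ (pow_pos hlam 2)]
      nlinarith [h3, h2]
    rw [← ENNReal.ofReal_mul (by positivity)]
    exact ENNReal.ofReal_le_ofReal h4
  calc ∫⁻ x in Y '' S ∩ Metric.ball (0 : EuclideanSpace ℝ (Fin 3)) a, ENNReal.ofReal (cylRadius x ^ 2)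
      ≤ ∫⁻ x in Y '' S ∩ Metric.ball (0 : EuclideanSpace ℝ (Fin 3)) a,
          ENNReal.ofReal (16 / lam ^ 2) * ENNReal.ofReal (frobeniusNormSq (fderiv ℝ (u s) x)) :=
        setLIntegral_mono' (hmeas.inter measurableSet_ball) hpt
    _ ≤ ∫⁻ x in Metric.ball (0 : EuclideanSpace ℝ (Fin 3)) a,
          ENNReal.ofReal (16 / lam ^ 2) * ENNReal.ofReal (frobeniusNormSq (fderiv ℝ (u s) x)) :=
        lintegral_mono_set Set.inter_subset_right
    _ = ENNReal.ofReal (16 / lam ^ 2) *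
          ∫⁻ x in Metric.ball (0 : EuclideanSpace ℝ (Fin 3)) a, ENNReal.ofReal (frobeniusNormSq (fderiv ℝ (u s) x)) :=
        lintegral_const_mul _ hFm

/-- **The single-scale `E`-budget of a classical member on a window**: `∫_{(−a²,0)×B_a} ‖∇u‖_F² ≤ c a^{1−ρ}` from the gauge hypothesis at ONE
scale `a` (cf. `SwirlfreeLedger.setLIntegral_window_frobenius_fderiv_le`, all scales). (ns-idea-11 g11, ported.) [cite: CaffarelliKohnNirenberg1982, §2] -/
theorem window_frobenius_le_single {ρ : ℝ} {c : ℝ≥0} {H : ℝ → EuclideanSpace ℝ (Fin 3) → EuclideanSpace ℝ (Fin 3) →L[ℝ] EuclideanSpace ℝ (Fin 3)}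
    (hH : HasWeakSpatialGradientOn (slab (EuclideanSpace ℝ (Fin 3)) (Set.Iio 0) isOpen_Iio) u H)
    (hcl : IsClassicalEulerSolutionOn (Set.Iio 0) 0 u p) {a : ℝ} (ha : 0 < a)
    (hE : ENNReal.ofReal (a ^ ρ) * cknE a (0 : ℝ × EuclideanSpace ℝ (Fin 3)) H ≤ (c : ℝ≥0∞)) :
    ∫⁻ z in Set.Ioo (-a ^ 2) 0 ×ˢ Metric.ball (0 : EuclideanSpace ℝ (Fin 3)) a,
        ENNReal.ofReal (frobeniusNormSq (fderiv ℝ (u z.1) z.2)) ≤ ENNReal.ofReal ((c : ℝ) * a ^ (1 - ρ)) := by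
  have h1 := TimePeriodic.setLIntegral_window_le_of_gaugeE (H := H) (T := a ^ 2) (R := a) ha le_rfl le_rfl hE
  refine le_trans (le_of_eq ?_) h1
  refine setLIntegral_congr_fun_ae (measurableSet_Ioo.prod measurableSet_ball) ?_
  have hsub : Set.Ioo (-a ^ 2) 0 ×ˢ Metric.ball (0 : EuclideanSpace ℝ (Fin 3)) a ⊆
      Set.Iio (0 : ℝ) ×ˢ (Set.univ : Set (EuclideanSpace ℝ (Fin 3))) :=
    Set.prod_mono Set.Ioo_subset_Iio_self (Set.subset_univ _)
  have hae := SwirlfreeLedger.weakGradient_ae_eq_fderiv_of_classical hH hcl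
  rw [ae_restrict_iff' (measurableSet_Iio.prod MeasurableSet.univ)] at hae
  filter_upwards [hae] with z hz hzQ
  rw [hz (hsub hzQ)]

/-- **MOMENT BUDGET on a window**: for a classical member with a flow `X` on `[t₁,t₀]`, `(t₁,t₀) ⊆ (−a²,0]`, whose images `X_s(S)` are measurable and
carry the ledger floor `λ r ≤ |curl u(s)|`, `∫_{t₁}^{t₀} ∫_{X_s(S) ∩ B_a} r² ≤ (16/λ²) · c a^{1−ρ}`. (ns-idea-11 g11, ported.) [cite: CaffarelliKohnNirenberg1982, §2] -/
theorem moment_budget {ρ : ℝ} {c : ℝ≥0} {H : ℝ → EuclideanSpace ℝ (Fin 3) → EuclideanSpace ℝ (Fin 3) →L[ℝ] EuclideanSpace ℝ (Fin 3)}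
    (hH : HasWeakSpatialGradientOn (slab (EuclideanSpace ℝ (Fin 3)) (Set.Iio 0) isOpen_Iio) u H)
    (hcl : IsClassicalEulerSolutionOn (Set.Iio 0) 0 u p) {a : ℝ} (ha : 0 < a)
    (hE : ENNReal.ofReal (a ^ ρ) * cknE a (0 : ℝ × EuclideanSpace ℝ (Fin 3)) H ≤ (c : ℝ≥0∞))
    {lam t₁ t₀ : ℝ} (hlam : 0 < lam) (ht₁ : -a ^ 2 ≤ t₁) (ht₀ : t₀ ≤ 0)
    {S : Set (EuclideanSpace ℝ (Fin 3))} {X : ℝ → EuclideanSpace ℝ (Fin 3) → EuclideanSpace ℝ (Fin 3)}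
    (hmeas : ∀ s ∈ Set.Icc t₁ t₀, MeasurableSet (X s '' S))
    (hfloor : ∀ s ∈ Set.Icc t₁ t₀, ∀ x ∈ S, lam * cylRadius (X s x) ≤ ‖curl (u s) (X s x)‖) :
    ∫⁻ s in Set.Ioo t₁ t₀, ∫⁻ x in X s '' S ∩ Metric.ball (0 : EuclideanSpace ℝ (Fin 3)) a, ENNReal.ofReal (cylRadius x ^ 2) ≤
      ENNReal.ofReal (16 / lam ^ 2) * ENNReal.ofReal ((c : ℝ) * a ^ (1 - ρ)) := by
  have hI0 : Set.Ioo t₁ t₀ ⊆ Set.Iio 0 := fun σ hσ => lt_of_lt_of_le hσ.2 ht₀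
  have hIW : Set.Ioo t₁ t₀ ⊆ Set.Ioo (-a ^ 2) 0 := fun σ hσ => ⟨lt_of_le_of_lt ht₁ hσ.1, lt_of_lt_of_le hσ.2 ht₀⟩
  have hstep : ∫⁻ s in Set.Ioo t₁ t₀, ∫⁻ x in X s '' S ∩ Metric.ball (0 : EuclideanSpace ℝ (Fin 3)) a, ENNReal.ofReal (cylRadius x ^ 2) ≤
      ∫⁻ s in Set.Ioo t₁ t₀, ENNReal.ofReal (16 / lam ^ 2) *
        ∫⁻ x in Metric.ball (0 : EuclideanSpace ℝ (Fin 3)) a, ENNReal.ofReal (frobeniusNormSq (fderiv ℝ (u s) x)) :=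
    setLIntegral_mono' measurableSet_Ioo fun s hs =>
      moment_le_frobenius hcl hlam (hI0 hs) (hmeas s (Set.Ioo_subset_Icc_self hs)) (hfloor s (Set.Ioo_subset_Icc_self hs)) a
  refine hstep.trans ?_
  rw [lintegral_const_mul' _ _ ENNReal.ofReal_ne_top]
  gcongr ?_ * ?_
  · exact le_rfl
  have hD_cont : ContinuousOn (Function.uncurry fun t x => fderiv ℝ (u t) x)
      (Set.Iio (0 : ℝ) ×ˢ (Set.univ : Set (EuclideanSpace ℝ (Fin 3)))) :=
    (hcl.smooth_velocity.fderiv_slice isOpen_Iio.uniqueDiffOn).continuousOn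
  have hG_cont : ContinuousOn (Function.uncurry fun (t : ℝ) (x : EuclideanSpace ℝ (Fin 3)) =>
      ENNReal.ofReal (frobeniusNormSq (fderiv ℝ (u t) x))) (Set.Iio (0 : ℝ) ×ˢ (Set.univ : Set (EuclideanSpace ℝ (Fin 3)))) :=
    ENNReal.continuous_ofReal.comp_continuousOn (ParabolicBump.continuous_frobeniusNormSq₃.comp_continuousOn hD_cont)
  have hGi : AEMeasurable (Function.uncurry fun (σ : ℝ) (x : EuclideanSpace ℝ (Fin 3)) =>
      ENNReal.ofReal (frobeniusNormSq (fderiv ℝ (u σ) x)))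
      ((volume.restrict (Set.Ioo (-a ^ 2) 0)).prod (volume.restrict (Metric.ball (0 : EuclideanSpace ℝ (Fin 3)) a))) := by
    rw [Measure.prod_restrict, ← Measure.volume_eq_prod]
    exact (hG_cont.mono (Set.prod_mono Set.Ioo_subset_Iio_self (Set.subset_univ _))).aemeasurable
      (measurableSet_Ioo.prod measurableSet_ball)
  calc ∫⁻ s in Set.Ioo t₁ t₀, ∫⁻ x in Metric.ball (0 : EuclideanSpace ℝ (Fin 3)) a, ENNReal.ofReal (frobeniusNormSq (fderiv ℝ (u s) x))
      ≤ ∫⁻ s in Set.Ioo (-a ^ 2) 0, ∫⁻ x in Metric.ball (0 : EuclideanSpace ℝ (Fin 3)) a,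
          ENNReal.ofReal (frobeniusNormSq (fderiv ℝ (u s) x)) := lintegral_mono_set hIW
    _ = ∫⁻ z in Set.Ioo (-a ^ 2) 0 ×ˢ Metric.ball (0 : EuclideanSpace ℝ (Fin 3)) a,
          ENNReal.ofReal (frobeniusNormSq (fderiv ℝ (u z.1) z.2)) := by
        rw [lintegral_lintegral hGi, Measure.prod_restrict, ← Measure.volume_eq_prod]
    _ ≤ ENNReal.ofReal ((c : ℝ) * a ^ (1 - ρ)) := window_frobenius_le_single hH hcl ha hE

/-! ### RESIDENCE ⇒ BANISHMENT -/

/-- **RESIDENCE ⇒ BANISHMENT**: if the window `(t₁,t₀) ⊆ (−9b²,0]` is so long that permanent residence of half of `S` (in volume) in `B(0,3b)` is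
unaffordable for the moment budget (tube bathtub `|A|²/(96 b) ≤ ∫_A r²`), then at some time of the window less than half of `S` is inside `B(0,3b)`.
(ns-idea-11 g11, ported.) [cite: CaffarelliKohnNirenberg1982, §2] -/
theorem exists_banished {ρ : ℝ} {c : ℝ≥0} {H : ℝ → EuclideanSpace ℝ (Fin 3) → EuclideanSpace ℝ (Fin 3) →L[ℝ] EuclideanSpace ℝ (Fin 3)}
    (hH : HasWeakSpatialGradientOn (slab (EuclideanSpace ℝ (Fin 3)) (Set.Iio 0) isOpen_Iio) u H)
    (hcl : IsClassicalEulerSolutionOn (Set.Iio 0) 0 u p) {b : ℝ} (hb : 0 < b)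
    (hE : ENNReal.ofReal ((3 * b) ^ ρ) * cknE (3 * b) (0 : ℝ × EuclideanSpace ℝ (Fin 3)) H ≤ (c : ℝ≥0∞))
    {lam t₁ t₀ : ℝ} (hlam : 0 < lam) (ht₁ : -(3 * b) ^ 2 ≤ t₁) (ht₀ : t₀ ≤ 0)
    {S : Set (EuclideanSpace ℝ (Fin 3))} {X : ℝ → EuclideanSpace ℝ (Fin 3) → EuclideanSpace ℝ (Fin 3)}
    (hmeas : ∀ s ∈ Set.Icc t₁ t₀, MeasurableSet (X s '' S))
    (hfloor : ∀ s ∈ Set.Icc t₁ t₀, ∀ x ∈ S, lam * cylRadius (X s x) ≤ ‖curl (u s) (X s x)‖)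
    (hrace : 16 / lam ^ 2 * ((c : ℝ) * (3 * b) ^ (1 - ρ)) < ((volume S).toReal / 2) ^ 2 / (32 * (3 * b)) * (t₀ - t₁)) :
    ∃ s₁ ∈ Set.Ioo t₁ t₀, volume (X s₁ '' S ∩ Metric.ball (0 : EuclideanSpace ℝ (Fin 3)) (3 * b)) < volume S / 2 := by
  by_contra hcon
  simp only [not_exists, not_and, not_lt] at hcon
  have hb3 : 0 < 3 * b := by positivity
  set V : ℝ := (volume S).toReal / 2 with hVdef
  have hV0 : 0 ≤ V := by positivity
  have key : ∀ s ∈ Set.Ioo t₁ t₀, ENNReal.ofReal (V ^ 2 / (32 * (3 * b))) ≤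
      ∫⁻ x in X s '' S ∩ Metric.ball (0 : EuclideanSpace ℝ (Fin 3)) (3 * b), ENNReal.ofReal (cylRadius x ^ 2) := by
    intro s hs
    have hsI : s ∈ Set.Icc t₁ t₀ := Set.Ioo_subset_Icc_self hs
    have hA : MeasurableSet (X s '' S ∩ Metric.ball (0 : EuclideanSpace ℝ (Fin 3)) (3 * b)) := (hmeas s hsI).inter measurableSet_ball
    have hAB : X s '' S ∩ Metric.ball (0 : EuclideanSpace ℝ (Fin 3)) (3 * b) ⊆ Metric.closedBall (0 : EuclideanSpace ℝ (Fin 3)) (3 * b) :=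
      Set.inter_subset_right.trans Metric.ball_subset_closedBall
    have hbath := NeedleAxisymBand.sq_volume_le_integral_cylRadius_sq hb3 hA hAB
    have hAfin : volume (X s '' S ∩ Metric.ball (0 : EuclideanSpace ℝ (Fin 3)) (3 * b)) < ⊤ :=
      (measure_mono hAB).trans_lt measure_closedBall_lt_top
    have hVA : V ≤ (volume (X s '' S ∩ Metric.ball (0 : EuclideanSpace ℝ (Fin 3)) (3 * b))).toReal := by
      have h1 : volume S / 2 ≤ volume (X s '' S ∩ Metric.ball (0 : EuclideanSpace ℝ (Fin 3)) (3 * b)) := hcon s hs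
      have h2 := ENNReal.toReal_mono hAfin.ne h1
      rw [ENNReal.toReal_div] at h2
      simpa [hVdef] using h2
    have h3 : V ^ 2 / (32 * (3 * b)) ≤ (volume (X s '' S ∩ Metric.ball (0 : EuclideanSpace ℝ (Fin 3)) (3 * b))).toReal ^ 2 / (32 * (3 * b)) := by
      gcongr
    have h4 := h3.trans hbath
    have hint : IntegrableOn (fun y : EuclideanSpace ℝ (Fin 3) => cylRadius y ^ 2)
        (X s '' S ∩ Metric.ball (0 : EuclideanSpace ℝ (Fin 3)) (3 * b)) volume :=
      ((continuous_cylRadius.pow 2).continuousOn.integrableOn_compact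
        (isCompact_closedBall (0 : EuclideanSpace ℝ (Fin 3)) (3 * b))).mono_set hAB
    rw [← ofReal_integral_eq_lintegral_ofReal hint (ae_of_all _ fun y => sq_nonneg _)]
    exact ENNReal.ofReal_le_ofReal h4
  have hlow : ENNReal.ofReal (V ^ 2 / (32 * (3 * b))) * volume (Set.Ioo t₁ t₀) ≤
      ∫⁻ s in Set.Ioo t₁ t₀, ∫⁻ x in X s '' S ∩ Metric.ball (0 : EuclideanSpace ℝ (Fin 3)) (3 * b), ENNReal.ofReal (cylRadius x ^ 2) := by
    calc ENNReal.ofReal (V ^ 2 / (32 * (3 * b))) * volume (Set.Ioo t₁ t₀)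
        = ∫⁻ _ in Set.Ioo t₁ t₀, ENNReal.ofReal (V ^ 2 / (32 * (3 * b))) := by rw [setLIntegral_const]
      _ ≤ _ := setLIntegral_mono' measurableSet_Ioo key
  have hup := moment_budget hH hcl hb3 hE hlam ht₁ ht₀ hmeas hfloor
  have h := hlow.trans hup
  rw [Real.volume_Ioo, ← ENNReal.ofReal_mul (by positivity), ← ENNReal.ofReal_mul (by positivity)] at h
  have h' := (ENNReal.ofReal_le_ofReal_iff (by positivity)).1 h
  linarith

/-- `(3b)^{1−ρ} ≤ 3 b^{1−ρ₁}` for `b ≥ 1`, `ρ₁ = min ρ 1`. (ns-idea-11 g11, ported.) [folklore] -/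
theorem three_b_rpow_le {b ρ : ℝ} (hb : 1 ≤ b) (hρ : 0 < ρ) : (3 * b) ^ (1 - ρ) ≤ 3 * b ^ (1 - min ρ 1) := by
  have hb0 : 0 < b := by linarith
  have h3b : (1 : ℝ) ≤ 3 * b := by linarith
  calc (3 * b) ^ (1 - ρ) ≤ (3 * b) ^ (1 - min ρ 1) :=
        Real.rpow_le_rpow_of_exponent_le h3b (by linarith [min_le_left ρ 1])
    _ = 3 ^ (1 - min ρ 1) * b ^ (1 - min ρ 1) := Real.mul_rpow (by norm_num) hb0.le
    _ ≤ 3 ^ (1 : ℝ) * b ^ (1 - min ρ 1) :=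
        mul_le_mul_of_nonneg_right (Real.rpow_le_rpow_of_exponent_le (by norm_num : (1 : ℝ) ≤ 3)
          (by linarith [lt_min hρ one_pos])) (by positivity)
    _ = 3 * b ^ (1 - min ρ 1) := by rw [Real.rpow_one]

end Summit.NavierStokesRegularity.NavierStokesRegularity.Theorems.PowerGaugeEulerLiouville.CasimirHaul

end
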